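import Summits.QuantumAdvantage.QuantumAdvantage.Theorems.WbwObfuscatedGluedTreesKowGenCoherent
import Summits.QuantumAdvantage.QuantumAdvantage.Theorems.WbwObfuscatedGluedTreesKowGenFactorisation
import Summits.QuantumAdvantage.QuantumAdvantage.Theorems.WbwObfuscatedGluedTrees.Negative.TypedTraps
import Mathlib.Data.List.Sections

/-!
# Stub `stub_depthTrap` — bounded depth kills clause (C) in the clear
# (crux `WbwObfuscatedGluedTrees`, stmt-QuantumAdvantage-2340; line `knowledge-of-walk-split`, STAGE 3)

Registered stub `stub_depthTrap` of the stage-3 skeleton (target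
`KnowledgeOfWalkSplit.Generator.Clear.ClearReduction`, conjunct 3, the TYPED TRAP): if the depth schedule
`D.δ (D.t n)` of the glued trees is bounded by `B` along the key schedule, then for EVERY admissible reference
presentation `Γ₁` clause (C) fails for the clear reference generator `(D.lineData Γ₁ P).gen₀` — so the
knowledge-free residual `ClearHardness` forces depth growth.

THE ATTACK (a deterministic polynomial-time walker).  On input `⟨1ⁿ, ⟨code ⟨2N, Γ₁ ℓ k⟩, e⟩⟩` enumerate
the FIXED finite list of walk-words `w ∈ {0,1,2}^{≤ 2B+1}` (it depends on `B` only), evaluate the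
endpoint `y_w` of each with the hypothesised polynomial-time evaluator of the evaluating walk model, and output the
first `y_w` with `y_w ≠ []`, `y_w ≠ e` and `y_{2∷w} = []` (a valid name other than the ENTRANCE listing at
most two neighbours).  Soundness: endpoints are vertex names, the listing at a vertex name is the sorted list
of its neighbours' names (`evalNbrs_clear`, `answerOf_eq_answerBits`, `decodeAnswer_answerBits`), so its
length is the degree, and for `1 ≤ d` the degree-`2` vertices are exactly ENTRANCE and EXIT
(`GluedTrees.degree_eq`).  Completeness: the role walk ENTRANCE → leftmost leaf → glued leaf → EXIT
(`Negative.RoleOrder`, `2d+1 ≤ 2B+1` edges) is realised by SOME index word, each next name occurring in the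
current listing.  The walker is `RandAlg.ofDet` of an `FP` function assembled by the `CodeFP` algebra over the
constant word list, so it is PPT; it outputs `name(EXIT) = (D.lineData Γ₁ P).answer s` on EVERY seed, the
level-`n` success average is `1`, and `not_superpolynomialDecay_of_frequently_le` refutes clause (C).
[folklore]; objects: ChildsEtAl2003 §2 (names, oracle, EXIT = the other degree-2 vertex).
-/

set_option linter.dupNamespace false

namespace Summit.QuantumAdvantage.QuantumAdvantage.Theorems.WbwObfuscatedGluedTrees.KnowledgeOfWalk.Generator

open Literature.Computability.Cryptography Literature.Computability.Complexity Filter Asymptotics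
open Literature.Computability.Cryptography.ObfuscatedGluedTrees
open Literature.Computability.QuantumComplexity
open Summit.QuantumAdvantage.QuantumAdvantage.Theorems.WbwObfuscatedGluedTrees.Negative
  (ClauseC not_superpolynomialDecay_of_frequently_le)
open Summit.QuantumAdvantage.QuantumAdvantage.Theorems.WbwObfuscatedGluedTrees.Negative.Graph
  (eq_entrance_of_depth_eq_zero eq_exit_of_depth_eq_zero)
open Summit.QuantumAdvantage.QuantumAdvantage.Theorems.WbwObfuscatedGluedTrees.KnowledgeOfWalk
  (WalkModel genClear keyed)
open Literature.Computability.QuantumComplexity.GluedTrees (Vertex CycleDatum nameVal nameOfVal nbrNames graph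
  depth entrance)

/-! ## The fixed word list and the selection program -/

/-- All walk-words over the letters `0, 1, 2` of length `≤ L` lie in one fixed finite list (the sections of
`[0,1,2]^m`, `m ≤ L`). [folklore] -/
private theorem exists_wordList (L : ℕ) :
    ∃ W : List (List ℕ), ∀ w : List ℕ, w.length ≤ L → (∀ i ∈ w, i ≤ 2) → w ∈ W := by
  refine ⟨((List.range (L + 1)).map fun m => (List.replicate m [0, 1, 2]).sections).flatten,
    fun w hw hi => ?_⟩
  rw [List.mem_flatten]
  refine ⟨_, List.mem_map.2 ⟨w.length, List.mem_range.2 (by omega), rfl⟩, ?_⟩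
  show w ∈ (List.replicate w.length [0, 1, 2]).sections
  rw [List.mem_sections]
  clear hw
  induction w with
  | nil => exact List.Forall₂.nil
  | cons a w ih =>
    rw [List.length_cons, List.replicate_succ]
    refine List.Forall₂.cons ?_ (ih fun i h => hi i (List.mem_cons_of_mem a h))
    have ha := hi a List.mem_cons_self
    interval_cases a <;> simp

/-- One step of the selection: `find?` on a cons is a branching on the head's test. [folklore] -/
private theorem find?_map_getD_cons {α β : Type} (p : α → Bool) (f : α → β) (d : β) (a : α) (l : List α) :
    (((a :: l).find? p).map f).getD d = if p a then f a else ((l.find? p).map f).getD d := by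
  cases h : p a <;> simp [h]

/-- **The selection program is computed on codes.**  For word-indexed maps `y w` and a map `e`, all computed
on codes, and a FIXED word list `W`, the map returning the first `y w t` (`w ∈ W`) with `y w t ≠ []`,
`y w t ≠ e t` and `y (2 ∷ w) t = []` (and `[]` if there is none) is computed on codes: finitely many
equality tests (`CodeFP.eq`) and branchings (`CodeFP.ite`). [folklore] -/
private theorem codeFP_select {τ : Type} {E : τ → List Bool} (y : List ℕ → τ → List Bool) (e : τ → List Bool)
    (hy : ∀ w, CodeFP E id (y w)) (he : CodeFP E id e) (W : List (List ℕ)) :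
    CodeFP E id fun t => ((W.find? fun w =>
      !decide (y w t = []) && (!decide (y w t = e t) && decide (y (2 :: w) t = []))).map fun w => y w t).getD [] := by
  have htest : ∀ w, CodeFP E CodeFP.bitE fun t =>
      !decide (y w t = []) && (!decide (y w t = e t) && decide (y (2 :: w) t = [])) := fun w =>
    ((CodeFP.eq Function.injective_id).comp₂ (hy w) (CodeFP.const E ([] : List Bool))).not.and
      (((CodeFP.eq Function.injective_id).comp₂ (hy w) he).not.and
        ((CodeFP.eq Function.injective_id).comp₂ (hy (2 :: w)) (CodeFP.const E ([] : List Bool))))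
  induction W with
  | nil => exact (CodeFP.const E ([] : List Bool)).congr fun t => rfl
  | cons w W ih =>
    exact ((htest w).ite (hy w) ih).congr fun t =>
      (find?_map_getD_cons (fun w => !decide (y w t = []) && (!decide (y w t = e t) && decide (y (2 :: w) t = [])))
        (fun w => y w t) [] w W).symm

/-! ## The evaluating model on a clear instance of the keyed glued trees -/

/-- `vecOf` reads a listed bit vector back. [folklore] -/
private theorem vecOf_ofFn {N : ℕ} (a : Fin N → Bool) : vecOf N (List.ofFn a) = a := by
  funext i
  simp [vecOf]

/-- Indexing through `listing`: position `i` of the optional listing is position `i` of the list. [folklore] -/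
private theorem listing_bind_getElem? (L : List (List Bool)) (i : ℕ) :
    ((listing L).bind fun l => l[i]?) = L[i]? := by
  cases L <;> rfl

/-- A listed name, read back from a list of `N`-bit names (`1 ≤ N`), is empty iff the position is past the
end. [folklore] -/
private theorem getD_getElem?_map_ofFn_eq_nil {N : ℕ} (hN : 1 ≤ N) (L : List (Fin N → Bool)) (i : ℕ) :
    ((L.map List.ofFn)[i]?).getD [] = [] ↔ L.length ≤ i := by
  rw [List.getElem?_map]
  cases h : L[i]? with
  | none => exact ⟨fun _ => List.getElem?_eq_none_iff.1 h, fun _ => rfl⟩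
  | some a =>
    refine ⟨fun h' => ?_, fun hle => ?_⟩
    · have := congrArg List.length h'
      rw [Option.map_some, Option.getD_some, List.length_ofFn, List.length_nil] at this
      omega
    · rw [List.getElem?_eq_none hle] at h
      cases h

/-- **Membership in the oracle's listing at a vertex name is adjacency**: the sorted listing
`gluedTreesOracle σ ν (ν v)` consists exactly of the names of the neighbours of `v`. [cite: ChildsEtAl2003, §2] -/
private theorem mem_gluedTreesOracle_naming {d N : ℕ} (σ : CycleDatum d) (ν : Vertex d ↪ (Fin N → Bool))
    (v : Vertex d) (a : Fin N → Bool) :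
    a ∈ gluedTreesOracle σ ν (ν v) ↔ ∃ u, (graph d σ).Adj v u ∧ ν u = a := by
  simp only [gluedTreesOracle, List.mem_map, Finset.mem_sort, Finset.mem_image, nbrNames_naming,
    Finset.mem_map, SimpleGraph.mem_neighborFinset]
  constructor
  · rintro ⟨_, ⟨_, ⟨u, hu, rfl⟩, rfl⟩, rfl⟩
    exact ⟨u, hu, (GluedTrees.nameOfVal_nameVal _).symm⟩
  · rintro ⟨u, hu, rfl⟩
    exact ⟨_, ⟨_, ⟨u, hu, rfl⟩, rfl⟩, GluedTrees.nameOfVal_nameVal _⟩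

/-- The listing at a vertex name has `degree v` entries. [cite: ChildsEtAl2003, §2] -/
private theorem length_gluedTreesOracle_naming {d N : ℕ} (σ : CycleDatum d) (ν : Vertex d ↪ (Fin N → Bool))
    (v : Vertex d) : (gluedTreesOracle σ ν (ν v)).length = (graph d σ).degree v := by
  rw [gluedTreesOracle, List.length_map, Finset.length_sort, nbrNames_naming,
    Finset.card_image_of_injective _ GluedTrees.nameVal_injective, Finset.card_map,
    SimpleGraph.card_neighborFinset_eq_degree]

/-- **The evaluating model on a clear instance, at a vertex name**: on `⟨code ⟨2N, C⟩, e⟩` with `|e| = N ≥ 4`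
and `C` computing the neighbour predicate `nbrBit σ ν`, the listing at `ν v` is the oracle's sorted listing of
the neighbours' names (as strings), read through `listing`. [folklore] -/
private theorem nbrs_clear_naming {d N : ℕ} (hd : 1 ≤ d) (hN : 4 ≤ N) (σ : CycleDatum d)
    (ν : Vertex d ↪ (Fin N → Bool)) (C : Circuit (Fin (N + N))) (hC : ∀ z, C.eval z = nbrBit σ ν z)
    (e : List Bool) (he : e.length = N) (v : Vertex d) :
    evalModel.nbrs (boolPair (encodeSizedCircuit ⟨N + N, C⟩) e) (List.ofFn (ν v)) =
      listing ((gluedTreesOracle σ ν (ν v)).map List.ofFn) := by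
  show evalNbrs _ _ = _
  rw [evalNbrs_clear C e _ he List.length_ofFn, answerOf_eq_answerBits hN σ ν C hC, vecOf_ofFn, namesOf,
    decodeAnswer_answerBits hd]

/-! ## Walk semantics: endpoints are vertex names, edges are realised by indices -/

/-- One more letter: from the name of `v`, letter `i` leads to position `i` of the listing at `v`. [folklore] -/
private theorem endpoint_cons_naming {d N : ℕ} (σ : CycleDatum d) (ν : Vertex d ↪ (Fin N → Bool))
    (x : List Bool)
    (h2 : ∀ v, evalModel.nbrs x (List.ofFn (ν v)) = listing ((gluedTreesOracle σ ν (ν v)).map List.ofFn))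
    {w : List ℕ} {v : Vertex d} (hw : evalModel.endpoint x w = some (List.ofFn (ν v))) (i : ℕ) :
    evalModel.endpoint x (i :: w) = ((gluedTreesOracle σ ν (ν v)).map List.ofFn)[i]? := by
  rw [WalkModel.endpoint_cons, hw, Option.bind_some, h2 v, listing_bind_getElem?]

/-- **Every endpoint is a vertex name** (the entrance is, and listed names are names of neighbours). [folklore] -/
private theorem endpoint_eq_naming {d N : ℕ} (σ : CycleDatum d) (ν : Vertex d ↪ (Fin N → Bool)) (x : List Bool)
    (h1 : evalModel.entrance x = List.ofFn (ν (entrance d)))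
    (h2 : ∀ v, evalModel.nbrs x (List.ofFn (ν v)) = listing ((gluedTreesOracle σ ν (ν v)).map List.ofFn))
    (w : List ℕ) {y : List Bool} (hw : evalModel.endpoint x w = some y) : ∃ v, y = List.ofFn (ν v) := by
  induction w generalizing y with
  | nil =>
    rw [WalkModel.endpoint_nil, h1, Option.some.injEq] at hw
    exact ⟨_, hw.symm⟩
  | cons i w ih =>
    cases hc : evalModel.endpoint x w with
    | none =>
      rw [WalkModel.endpoint_cons, hc] at hw
      cases hw
    | some cur =>
      obtain ⟨v, rfl⟩ := ih hc
      rw [endpoint_cons_naming σ ν x h2 hc i, List.getElem?_map, Option.map_eq_some_iff] at hw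
      obtain ⟨a, ha, rfl⟩ := hw
      obtain ⟨u, -, hu⟩ := (mem_gluedTreesOracle_naming σ ν v a).1 (List.mem_of_getElem? ha)
      exact ⟨u, by rw [hu]⟩

/-- **Edges are realised by letters**: if the walk `w` ends at the name of `v` and `u` is a neighbour of `v`,
some letter `i ≤ 2` extends it to a walk ending at the name of `u` (`1 ≤ d`: at most three neighbours). [folklore] -/
private theorem endpoint_step {d N : ℕ} (hd : 1 ≤ d) (σ : CycleDatum d) (ν : Vertex d ↪ (Fin N → Bool))
    (x : List Bool)
    (h2 : ∀ v, evalModel.nbrs x (List.ofFn (ν v)) = listing ((gluedTreesOracle σ ν (ν v)).map List.ofFn))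
    {w : List ℕ} {v u : Vertex d} (hw : evalModel.endpoint x w = some (List.ofFn (ν v)))
    (hvu : (graph d σ).Adj v u) : ∃ i, i ≤ 2 ∧ evalModel.endpoint x (i :: w) = some (List.ofFn (ν u)) := by
  obtain ⟨i, hi, hiu⟩ := List.mem_iff_getElem.1 ((mem_gluedTreesOracle_naming σ ν v (ν u)).2 ⟨u, hvu, rfl⟩)
  refine ⟨i, ?_, ?_⟩
  · have := length_gluedTreesOracle_le hd σ ν (ν v)
    omega
  · rw [endpoint_cons_naming σ ν x h2 hw i, List.getElem?_map, List.getElem?_eq_getElem hi, Option.map_some, hiu]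

open Summit.QuantumAdvantage.QuantumAdvantage.Theorems.WbwObfuscatedGluedTrees.Negative.RoleOrder in
/-- **A short index word reaches the EXIT**: the role walk ENTRANCE → leftmost leaf (`d` child edges) → its
first glued leaf → EXIT (`d` parent edges) of `Negative.RoleOrder` is a walk of `2d+1` edges, so by
`endpoint_step` some word of length `≤ 2d+1` over `{0,1,2}` ends at `name(EXIT)`. [folklore] -/
private theorem exists_word_to_exit {d N : ℕ} (hd : 1 ≤ d) (σ : CycleDatum d) (ν : Vertex d ↪ (Fin N → Bool))
    (x : List Bool) (h1 : evalModel.entrance x = List.ofFn (ν (entrance d)))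
    (h2 : ∀ v, evalModel.nbrs x (List.ofFn (ν v)) = listing ((gluedTreesOracle σ ν (ν v)).map List.ofFn)) :
    ∃ w : List ℕ, w.length ≤ 2 * d + 1 ∧ (∀ i ∈ w, i ≤ 2) ∧
      evalModel.endpoint x w = some (List.ofFn (ν (GluedTrees.exit d))) := by
  -- going down the left tree
  have hdown : ∀ k, k ≤ d → ∃ w : List ℕ, w.length = k ∧ (∀ i ∈ w, i ≤ 2) ∧
      evalModel.endpoint x w = some (List.ofFn (ν (descend (entrance d) k))) := by
    intro k
    induction k with
    | zero => exact fun _ => ⟨[], rfl, fun i hi => by simp at hi, by rw [WalkModel.endpoint_nil, h1]; rfl⟩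
    | succ k ih =>
      intro hk
      obtain ⟨w, hwl, hwi, hw⟩ := ih (by omega)
      obtain ⟨i, hi, hiw⟩ := endpoint_step hd σ ν x h2 hw (adj_descend_succ σ k (by omega))
      exact ⟨i :: w, by rw [List.length_cons, hwl], List.forall_mem_cons.2 ⟨hi, hwi⟩, hiw⟩
  obtain ⟨w₁, hw₁l, hw₁i, hw₁⟩ := hdown d le_rfl
  -- the glued edge
  obtain ⟨j, hj, hjw⟩ := endpoint_step hd σ ν x h2 hw₁ (adj_glued_step hd σ)
  -- going up the right tree
  have hup : ∀ k, k ≤ d → ∃ w : List ℕ, w.length = d + 1 + k ∧ (∀ i ∈ w, i ≤ 2) ∧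
      evalModel.endpoint x w = some (List.ofFn (ν (ascend (GluedTrees.cross₁ σ (descend (entrance d) d)) k))) := by
    intro k
    induction k with
    | zero =>
      exact fun _ => ⟨j :: w₁, by rw [List.length_cons, hw₁l], List.forall_mem_cons.2 ⟨hj, hw₁i⟩, hjw⟩
    | succ k ih =>
      intro hk
      obtain ⟨w, hwl, hwi, hw⟩ := ih (by omega)
      obtain ⟨i, hi, hiw⟩ := endpoint_step hd σ ν x h2 hw (adj_ascend_succ hd σ k (by omega))
      exact ⟨i :: w, by rw [List.length_cons, hwl]; ring, List.forall_mem_cons.2 ⟨hi, hwi⟩, hiw⟩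
  obtain ⟨w, hwl, hwi, hw⟩ := hup d le_rfl
  refine ⟨w, by omega, hwi, ?_⟩
  rw [hw, ← roleWalk_eq_exit σ]
  rfl

/-! ## The selection is `name(EXIT)` -/

/-- **Soundness and completeness of the walker's test.**  With `Y w` the endpoint of `w` (`[]` if invalid)
and `W` containing all words over `{0,1,2}` of length `≤ 2d+1`, the first `Y w` (`w ∈ W`) with `Y w ≠ []`,
`Y w ≠ e = name(ENTRANCE)` and `Y (2 ∷ w) = []` is `name(EXIT)`: a passing endpoint is the name of a vertex
of degree `≤ 2` other than the ENTRANCE, i.e. the EXIT (`GluedTrees.degree_eq`), and the word of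
`exists_word_to_exit` passes (the EXIT has degree `2`, names have length `N ≥ 1`, `ν` is injective). [folklore] -/
private theorem select_eq_exit {d N : ℕ} (hd : 1 ≤ d) (hN : 1 ≤ N) (σ : CycleDatum d)
    (ν : Vertex d ↪ (Fin N → Bool)) (x e : List Bool) (he : List.ofFn (ν (entrance d)) = e)
    (h1 : evalModel.entrance x = e)
    (h2 : ∀ v, evalModel.nbrs x (List.ofFn (ν v)) = listing ((gluedTreesOracle σ ν (ν v)).map List.ofFn))
    (Y : List ℕ → List Bool) (hY : ∀ w, Y w = (evalModel.endpoint x w).getD [])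
    (W : List (List ℕ)) (hW : ∀ w : List ℕ, w.length ≤ 2 * d + 1 → (∀ i ∈ w, i ≤ 2) → w ∈ W) :
    ((W.find? fun w => !decide (Y w = []) && (!decide (Y w = e) && decide (Y (2 :: w) = []))).map Y).getD [] =
      List.ofFn (ν (GluedTrees.exit d)) := by
  -- soundness of the test
  have hsound : ∀ w, (!decide (Y w = []) && (!decide (Y w = e) && decide (Y (2 :: w) = []))) = true →
      Y w = List.ofFn (ν (GluedTrees.exit d)) := by
    intro w hw
    simp only [Bool.and_eq_true, Bool.not_eq_true', decide_eq_false_iff_not, decide_eq_true_eq] at hw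
    obtain ⟨hne, hne', h2w⟩ := hw
    rw [hY] at hne hne' h2w ⊢
    cases hep : evalModel.endpoint x w with
    | none =>
      rw [hep] at hne
      exact absurd rfl hne
    | some y' =>
      obtain ⟨v, rfl⟩ := endpoint_eq_naming σ ν x (h1.trans he.symm) h2 w hep
      rw [hep, Option.getD_some] at hne'
      rw [endpoint_cons_naming σ ν x h2 hep 2, getD_getElem?_map_ofFn_eq_nil hN,
        length_gluedTreesOracle_naming] at h2w
      rw [Option.getD_some]
      have h0 : depth v = 0 := by
        by_contra h0
        rw [GluedTrees.degree_eq hd, if_neg h0] at h2w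
        omega
      cases hb : v.1 with
      | false =>
        have hv := eq_entrance_of_depth_eq_zero h0 hb
        subst hv
        exact absurd he hne'
      | true => rw [eq_exit_of_depth_eq_zero h0 hb]
  -- completeness on the word to the EXIT
  obtain ⟨w₀, hw₀l, hw₀i, hw₀⟩ := exists_word_to_exit hd σ ν x (h1.trans he.symm) h2
  have hgood : (!decide (Y w₀ = []) && (!decide (Y w₀ = e) && decide (Y (2 :: w₀) = []))) = true := by
    simp only [Bool.and_eq_true, Bool.not_eq_true', decide_eq_false_iff_not, decide_eq_true_eq]
    refine ⟨?_, ?_, ?_⟩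
    · rw [hY, hw₀, Option.getD_some]
      intro h
      have := congrArg List.length h
      rw [List.length_ofFn, List.length_nil] at this
      omega
    · rw [hY, hw₀, Option.getD_some, ← he]
      intro h
      exact GluedTrees.entrance_ne_exit d (ν.injective (List.ofFn_injective h)).symm
    · rw [hY, endpoint_cons_naming σ ν x h2 hw₀ 2, getD_getElem?_map_ofFn_eq_nil hN,
        length_gluedTreesOracle_naming, GluedTrees.degree_of_depth_eq_zero σ GluedTrees.depth_exit hd]
  -- the selection
  cases hf : W.find? (fun w => !decide (Y w = []) && (!decide (Y w = e) && decide (Y (2 :: w) = []))) with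
  | none =>
    rw [List.find?_eq_none] at hf
    exact absurd hgood (by simpa using hf w₀ (hW w₀ hw₀l hw₀i))
  | some w =>
    rw [Option.map_some, Option.getD_some]
    have hpw := List.find?_some hf
    exact hsound w hpw

/-! ## The registered stub -/

/-- **STUB `stub_depthTrap` — typed trap: bounded depth kills clause (C) in the clear.**  If the depth
schedule is bounded along the key schedule (`D.δ (D.t n) ≤ B`), then for every admissible reference
presentation `Γ₁` the brute-force walker — evaluate all walk-words over `{0,1,2}` of length `≤ 2B+1` with the
polynomial-time evaluator of the evaluating walk model, output the first endpoint that is valid, differs from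
the ENTRANCE and lists at most two neighbours — is a deterministic PPT algorithm (`RandAlg.ofDet` of a
`CodeFP`-assembled `FP` function) that outputs `name(EXIT) = (D.lineData Γ₁ P).answer s` on EVERY seed `s`
(key `k = s.take (4 t |s|)`, level `ℓ = |k|/4 = t |s|` by clause (4) of `GenAdmissible`, circuit
`Γ₁ ℓ k ≡ nbrBit σ ν` by clause (7) and `RefAdmissible` (2), depth `δ ℓ ≤ B`); hence the level-`n` success
average is `1` for every `n` and clause (C) for the clear reference generator fails
(`not_superpolynomialDecay_of_frequently_le`). [folklore] -/
theorem stub_depthTrap :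
    ∀ (D : MasterData) (Γ₁ : D.Presentation) (O : CircuitObfuscator) (P : PuncturablePRFScheme),
      GenAdmissible D O P → RefAdmissible D Γ₁ O →
      (∃ B : ℕ, ∀ n : ℕ, D.δ (D.t n) ≤ B) →
      (∃ ev : List Bool → List Bool, PolyTimeComputable (id : List Bool → List Bool) (id : List Bool → List Bool) ev ∧
        ∀ (u e : List Bool) (C : SizedCircuit) (w : List ℕ),
          ev (boolPair (boolPair u (boolPair (encodeSizedCircuit C) e)) (encodingListNatBool.encode w)) =
            (evalModel.endpoint (boolPair (encodeSizedCircuit C) e) w).getD []) →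
      ¬ ClauseC (D.lineData Γ₁ P).gen₀ (D.lineData Γ₁ P).answer := by
  intro D Γ₁ O P hadm href hB hev hC
  obtain ⟨_, _, _, h4, _, _, h7, _⟩ := hadm
  obtain ⟨_, r2, _⟩ := href
  obtain ⟨B, hB⟩ := hB
  obtain ⟨ev, hev, hspec⟩ := hev
  obtain ⟨W, hW⟩ := exists_wordList (2 * B + 1)
  -- the brute-force walker as an `FP` string function of `⟨u, ⟨code, e⟩⟩`
  obtain ⟨f, hf, hfs⟩ := codeFP_select (E := CodeFP.pairE id (CodeFP.pairE id id))
    (fun (w : List ℕ) (t : List Bool × List Bool × List Bool) =>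
      ev (boolPair (boolPair t.1 (boolPair t.2.1 t.2.2)) (encodingListNatBool.encode w)))
    (fun t => t.2.2)
    (fun w => (CodeFP.of_fn (eα := CodeFP.pairE (CodeFP.pairE id (CodeFP.pairE id id)) id) (eβ := id)
        (g := fun p : (List Bool × List Bool × List Bool) × List Bool =>
          ev (boolPair (boolPair p.1.1 (boolPair p.1.2.1 p.1.2.2)) p.2)) ev hev (fun _ => rfl)).comp
      ((CodeFP.id _).pair (CodeFP.const _ (encodingListNatBool.encode w))))
    ((CodeFP.snd id id).comp (CodeFP.snd id (CodeFP.pairE id id))) W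
  set A : RandAlg (List Bool) (List Bool) := RandAlg.ofDet f with hA
  have hPPT : IsPPT A id := RandAlg.IsPolyTime.ofDet_holds hf
  -- on EVERY seed the walker outputs `name(EXIT)`, the keyed answer
  have hout : ∀ u s : List Bool, f (boolPair u ((D.lineData Γ₁ P).gen₀ s)) = (D.lineData Γ₁ P).answer s := by
    intro u s
    have hℓ := length_take_keyMaterial_div_four D h4 s
    set k : List Bool := s.take (4 * D.t s.length)
    set ℓ : ℕ := k.length / 4
    have hgen : (D.lineData Γ₁ P).gen₀ s =
        boolPair (encodeSizedCircuit ⟨D.Nℓ ℓ + D.Nℓ ℓ, Γ₁ ℓ k⟩) (D.entranceNameℓ P ℓ k) := rfl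
    have hans : (D.lineData Γ₁ P).answer s = D.exitNameℓ P ℓ k := rfl
    have hd : 1 ≤ D.δ ℓ := D.δ_pos ℓ
    have hdB : D.δ ℓ ≤ B := by rw [hℓ]; exact hB _
    have hN : 4 ≤ nameLen (D.π ℓ) (D.δ ℓ) := by simp only [nameLen, labelLen]; omega
    have hN1 : 1 ≤ nameLen (D.π ℓ) (D.δ ℓ) := by omega
    have hCk : ∀ z, (Γ₁ ℓ k).eval z =
        nbrBit (cycleOf P (D.π ℓ) (MasterData.keyℓ ℓ k 2) (MasterData.keyℓ ℓ k 3) (D.δ ℓ))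
          (naming P (D.π ℓ) (MasterData.keyℓ ℓ k 0) (MasterData.keyℓ ℓ k 1) (D.δ ℓ)) z := fun z => by
      rw [← (r2 ℓ k).2.2 z, h7 ℓ k z]
    have he : List.ofFn (naming P (D.π ℓ) (MasterData.keyℓ ℓ k 0) (MasterData.keyℓ ℓ k 1) (D.δ ℓ)
        (entrance _)) = D.entranceNameℓ P ℓ k := ofFn_naming _ _ _ _ _ _
    have hx : List.ofFn (naming P (D.π ℓ) (MasterData.keyℓ ℓ k 0) (MasterData.keyℓ ℓ k 1) (D.δ ℓ)
        (GluedTrees.exit _)) = D.exitNameℓ P ℓ k := ofFn_naming _ _ _ _ _ _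
    have hNe : (D.entranceNameℓ P ℓ k).length = D.Nℓ ℓ := length_vname _ _ _ _ _ _
    rw [hgen, hans, ← hx]
    have hf1 := hfs (u, encodeSizedCircuit ⟨D.Nℓ ℓ + D.Nℓ ℓ, Γ₁ ℓ k⟩, D.entranceNameℓ P ℓ k)
    simp only [CodeFP.pairE_apply, id_eq] at hf1
    rw [hf1]
    exact select_eq_exit hd hN1 _ _
      (boolPair (encodeSizedCircuit ⟨D.Nℓ ℓ + D.Nℓ ℓ, Γ₁ ℓ k⟩) (D.entranceNameℓ P ℓ k)) (D.entranceNameℓ P ℓ k)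
      he (by show (boolUnpair (boolPair _ _)).2 = _; rw [boolUnpair_boolPair])
      (nbrs_clear_naming hd hN _ _ (Γ₁ ℓ k) hCk _ hNe)
      (fun w => ev (boolPair (boolPair u (boolPair (encodeSizedCircuit ⟨D.Nℓ ℓ + D.Nℓ ℓ, Γ₁ ℓ k⟩)
        (D.entranceNameℓ P ℓ k))) (encodingListNatBool.encode w)))
      (fun w => hspec u _ ⟨_, Γ₁ ℓ k⟩ w) W (fun w hw hi => hW w (by omega) hi)
  -- success probability `1` at every level: clause (C) fails for the walker
  refine not_superpolynomialDecay_of_frequently_le one_pos (Frequently.of_forall fun n => ?_) (hC A hPPT)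
  have hpr : ∀ s : List Bool, A.pr id (boolPair (Computability.unaryEncodeNat n) ((D.lineData Γ₁ P).gen₀ s))
      {y | (D.lineData Γ₁ P).answer s <+: y} = 1 := fun s => by
    classical
    rw [hA, RandAlg.pr_ofDet, if_pos]
    rw [Set.mem_setOf_eq, hout]
  show 1 ≤ uniformAvg n _
  simp only [uniformAvg, hpr]
  simp [card_vector]

end Summit.QuantumAdvantage.QuantumAdvantage.Theorems.WbwObfuscatedGluedTrees.KnowledgeOfWalk.Generator
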